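import Literature.NumberTheory.ComplexMultiplication.CMOrderWeakClassesGoodRepresentatives
import Literature.NumberTheory.ComplexMultiplication.CMOrderGorenstein
import HarnessLib

/-!
# Representatives of `W̄(S)` between `𝔣` and `T` (MARSEGLIA 2019 PROPOSITION 5.1): for over-orders `S ⊆ T` of `R`
# with `SᵗT` invertible in `T` and an ideal `𝔣 ⊆ S` with `T ⊆ (𝔣:𝔣)`, every class in `W̄(S)` has a representative
# `I` with `𝔣 ⊆ I ⊆ T` — in particular for `𝔣 = (S:T)`

Family `hodge`, lane `lit-hodgefound` (Track 2 foundations library; seat p15, row g26-#15), topic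
`Literature/NumberTheory/ComplexMultiplication`, namespaces `Literature.NumberTheory.ComplexMultiplication.EndOrder`
(§1, any order `𝔯 = endOrder ρ`) and `…CMTypeLattice` (§2, `𝔯 = endOrder (M_μ)`, trace duals as in `CMOrderGorenstein`:
`↑TS = traceDual ℤ ℚ ↑MS` says «`TS = Sᵗ`»).  THEOREMS ONLY: no definition, no instance, no named fact (net Literature
debt `0`).  Vocabulary: over-orders are idempotents `MS = MS·MS ≠ 0`, `MT` with `MS ⊆ MT`; `(I:J) = I / J`; «`(I′:I′) = S`»
is `I′ / I′ = MS`; «`SᵗT` invertible in `T`» is `∃ N′, (TS·MT)·N′ = MT`; «`T ⊆ (𝔣:𝔣)`» is `MT·F = F`; weak equivalence is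
`1 ∈ (I:J)(J:I)`, and the representative is produced as `I = L₀I′` with `L₀ ∈ 𝓘(𝔯)` invertible in `𝔯` itself
(`CMOrderWeakClassesGoodRepresentatives`, Lemma 6.1 of Marseglia 2025).

## Source, VERBATIM

S. Marseglia, *Computing the ideal class monoid of an order*, J. Lond. Math. Soc. (2) 101 (2020) 984–1007
[Marseglia2019] (arXiv:1805.09671, held `paper:arxiv-1805.09671`, chunk p0010): "Proposition 5.1. Let `T` be any
over-order of `S` such that `S^tT` is invertible in `T`. Let `𝔣` be an ideal contained in `S` such that `T ⊆ (𝔣:𝔣)`.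
Then every class in `W̄k(S)` has a representative `I` satisfying `𝔣 ⊂ I ⊂ T`.  Proof. Let `I′` be any fractional ideal
with `(I′:I′) = S`. By Lemma 2.3 we have that `I′(I′)^tT = S^tT` and hence it follows that `I′T` is invertible in `T`.
Let `J` be a representative of the pre-image under the surjective map `Pic(S) → Pic(T)` of the class of `(T:I′T)` and
put `I = I′J`. Note that `[I′] = [I]` in `W̄k(S)` and that `IT = T`, which implies that `I ⊆ T`. On the other hand, as
`𝔣T = 𝔣` we get that `𝔣I = 𝔣TI = 𝔣T = 𝔣`, and, since `𝔣 ⊆ (I:I)`, we obtain that `𝔣 = 𝔣I ⊆ I`, and we can conclude that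
`𝔣 ⊆ I ⊆ T`. □  The previous proposition tells us that in order to compute the representatives of `W̄k(S)` we can look
at the sub-`S`-modules of the finite quotient `T/𝔣`. … The natural choice is to take `T` the smallest over-order of `S`
with `S^tT` invertible in `T` and as `𝔣`, the colon ideal `(S:T)`, which is the biggest fractional `T`-ideal in `S`."

## What is formalised

* §1: `EndOrder.div_le_of_one_mem` (`(S:T) ⊆ S` for `T ∋ 1`).
* §2: **`CMTypeLattice.mul_mul_mul_mul_eq_of_div_self_eq`** (`(I′T)((I′)ᵗT) = SᵗT` for `(I′:I′) = S`, Lemma 2.3),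
  **`exists_mul_mul_eq_of_div_self_eq`** (`I′T` is invertible in `T`), **`one_mem_div_mul_div_mul_of_div_self_eq`**
  (`I′T` is weakly equivalent to `T`), **`exists_le_of_div_self_eq`** (PROPOSITION 5.1: `I = L₀I′ ~ I′`, `IT = T`,
  `𝔣 ⊆ I ⊆ T`), **`exists_div_le_of_div_self_eq`** (the choice `𝔣 = (S:T)`).
-/

noncomputable section

open scoped nonZeroDivisors NumberField
open NumberField Module FractionalIdeal
open Submodule (traceDual)

namespace Literature.NumberTheory.ComplexMultiplication

/-! ## §1 `(S:T) ⊆ S` -/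

namespace EndOrder

variable {K : Type} [Field K] [NumberField K]
variable {ι : Type} [Fintype ι] [DecidableEq ι] {ρ : K →ₐ[ℚ] Matrix ι ι ℚ}
variable [IsFractionRing (endOrder ρ) K]

/-- **`(S:T) ⊆ S` when `1 ∈ T`** («the colon ideal `(S:T)`, which is the biggest fractional `T`-ideal in `S`»).
[cite: Marseglia2019, §5 (after Prop. 5.1), p. 10] -/
theorem div_le_of_one_mem {S T : FractionalIdeal (endOrder ρ)⁰ K} (hT0 : T ≠ 0) (h1 : (1 : K) ∈ T) : S / T ≤ S :=
  fun x hx ↦ by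
    have h := (mem_div_iff_of_ne_zero hT0).1 hx 1 h1
    rwa [mul_one] at h

end EndOrder

/-! ## §2 Proposition 5.1 for the order `𝔯 = endOrder (M_μ)` -/

namespace CMTypeLattice

variable {K : Type} [Field K] [NumberField K]
variable {ι : Type} [Fintype ι] [DecidableEq ι] [Nonempty ι] (μ : Basis ι ℚ K)
variable [IsFractionRing (endOrder (Algebra.leftMulMatrix μ)) K]

omit [Nonempty ι] in
/-- **«By Lemma 2.3 we have that `I′(I′)ᵗT = SᵗT`»**: `(I′T)((I′)ᵗT) = SᵗT` for `(I′:I′) = S = MS` and an over-order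
`T = MT` (`↑TI = (I′)ᵗ`, `↑TS = Sᵗ`). [cite: Marseglia2019, §5, proof of Prop. 5.1, p. 10; §2 Lemma 2.3
(«`S = (I:I) ⟺ IIᵗ = Sᵗ`»), p. 4] -/
theorem mul_mul_mul_mul_eq_of_div_self_eq {I' TI MS TS MT : FractionalIdeal (endOrder (Algebra.leftMulMatrix μ))⁰ K}
    (hTT : MT * MT = MT) (hI' : I' ≠ 0) (hTI0 : TI ≠ 0) (hMS0 : MS ≠ 0) (hIS : I' / I' = MS)
    (hTI : (TI : Submodule (endOrder (Algebra.leftMulMatrix μ)) K) =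
      traceDual ℤ ℚ (I' : Submodule (endOrder (Algebra.leftMulMatrix μ)) K))
    (hTS : (TS : Submodule (endOrder (Algebra.leftMulMatrix μ)) K) =
      traceDual ℤ ℚ (MS : Submodule (endOrder (Algebra.leftMulMatrix μ)) K)) :
    I' * MT * (TI * MT) = TS * MT := by
  have hITI : I' * TI = TS := (div_self_eq_iff_mul_traceDual_eq μ hI' hTI0 hMS0 hTI hTS).1 hIS
  rw [mul_mul_mul_comm, hITI, hTT]

omit [Nonempty ι] in
/-- **«hence it follows that `I′T` is invertible in `T`»**: `(I′T)·X = T` for `X = (I′)ᵗT·N′` when `SᵗT·N′ = T`.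
[cite: Marseglia2019, §5, proof of Prop. 5.1, p. 10] -/
theorem exists_mul_mul_eq_of_div_self_eq {I' MS TS MT : FractionalIdeal (endOrder (Algebra.leftMulMatrix μ))⁰ K}
    (hTT : MT * MT = MT) (hI' : I' ≠ 0) (hMS0 : MS ≠ 0) (hIS : I' / I' = MS)
    (hTS : (TS : Submodule (endOrder (Algebra.leftMulMatrix μ)) K) =
      traceDual ℤ ℚ (MS : Submodule (endOrder (Algebra.leftMulMatrix μ)) K))
    (hinv : ∃ N' : FractionalIdeal (endOrder (Algebra.leftMulMatrix μ))⁰ K, TS * MT * N' = MT) :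
    ∃ X : FractionalIdeal (endOrder (Algebra.leftMulMatrix μ))⁰ K, I' * MT * X = MT := by
  obtain ⟨TI, hTI0, hTI⟩ := exists_coe_eq_traceDual μ hI'
  obtain ⟨N', hN'⟩ := hinv
  refine ⟨TI * MT * N', ?_⟩
  rw [← mul_assoc, mul_mul_mul_mul_eq_of_div_self_eq μ hTT hI' hTI0 hMS0 hIS hTI hTS, hN']

/-- **`I′T` is weakly equivalent to `T`: `1 ∈ (T : I′T)(I′T : T)`** under the hypotheses of Prop. 5.1 (`I′T` is
invertible in `T`, and an ideal invertible in the over-order `T` is weakly equivalent to `T`). [cite: Marseglia2019,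
§5, proof of Prop. 5.1, p. 10; §4 (after Def. 4.2: «an ideal is invertible if and only if it is weakly equivalent to
its multiplicator ring»), p. 8] -/
theorem one_mem_div_mul_div_mul_of_div_self_eq {I' MS TS MT : FractionalIdeal (endOrder (Algebra.leftMulMatrix μ))⁰ K}
    (hTT : MT * MT = MT) (hMT0 : MT ≠ 0) (hI' : I' ≠ 0) (hMS0 : MS ≠ 0) (hIS : I' / I' = MS)
    (hTS : (TS : Submodule (endOrder (Algebra.leftMulMatrix μ)) K) =
      traceDual ℤ ℚ (MS : Submodule (endOrder (Algebra.leftMulMatrix μ)) K))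
    (hinv : ∃ N' : FractionalIdeal (endOrder (Algebra.leftMulMatrix μ))⁰ K, TS * MT * N' = MT) :
    (1 : K) ∈ MT / (I' * MT) * (I' * MT / MT) := by
  obtain ⟨X, hX⟩ := exists_mul_mul_eq_of_div_self_eq μ hTT hI' hMS0 hIS hTS hinv
  have hA0 : I' * MT ≠ 0 := EndOrder.fractionalIdeal_mul_ne_zero hI' hMT0
  -- `X ⊆ (T : I′T)`, `I′T ⊆ (I′T : T)`, and `1 ∈ T = (I′T)·X`
  have hXle : X ≤ MT / (I' * MT) := (le_div_iff_mul_le hA0).2 (by rw [mul_comm, hX])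
  have hAle : I' * MT ≤ I' * MT / MT := (le_div_iff_mul_le hMT0).2 (by rw [mul_assoc, hTT])
  have h1 : (1 : K) ∈ X * (I' * MT) := by
    rw [mul_comm, hX]; exact FractionalIdeal.one_le.1 (EndOrder.one_le_of_mul_self_eq hTT hMT0)
  exact mul_le_mul' hXle hAle h1

/-- **PROPOSITION 5.1: for over-orders `S = MS ⊆ T = MT` with `SᵗT` invertible in `T` and an ideal `𝔣 = F ⊆ S` with
`T𝔣 = 𝔣`, every `I′` with `(I′:I′) = S` is weakly equivalent to some `I = L₀I′` (`L₀ ∈ 𝓘(𝔯)`) with `IT = T` and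
`𝔣 ⊆ I ⊆ T`** («`IT = T`, which implies that `I ⊆ T` … `𝔣I = 𝔣TI = 𝔣T = 𝔣`, and, since `𝔣 ⊆ (I:I)`, … `𝔣 ⊆ I`»; the
printed `J ∈ Pic(S)` is sharpened to `L₀ ∈ 𝓘(𝔯)` by Lemma 6.1 of `CMOrderWeakClassesGoodRepresentatives`).
[cite: Marseglia2019, §5 Prop. 5.1, p. 10] [cite: Marseglia2025LocalIsomorphism, §6 Lemma 6.1, p. 11] -/
theorem exists_le_of_div_self_eq {I' MS TS MT F : FractionalIdeal (endOrder (Algebra.leftMulMatrix μ))⁰ K}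
    (hTT : MT * MT = MT) (hMT0 : MT ≠ 0) (hI' : I' ≠ 0) (hMS0 : MS ≠ 0) (hIS : I' / I' = MS)
    (hTS : (TS : Submodule (endOrder (Algebra.leftMulMatrix μ)) K) =
      traceDual ℤ ℚ (MS : Submodule (endOrder (Algebra.leftMulMatrix μ)) K))
    (hinv : ∃ N' : FractionalIdeal (endOrder (Algebra.leftMulMatrix μ))⁰ K, TS * MT * N' = MT)
    (hFS : F ≤ MS) (hTF : MT * F = F) :
    ∃ I : FractionalIdeal (endOrder (Algebra.leftMulMatrix μ))⁰ K,
      (∃ L₀ : FractionalIdeal (endOrder (Algebra.leftMulMatrix μ))⁰ K, IsUnit L₀ ∧ I = L₀ * I') ∧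
      (1 : K) ∈ I / I' * (I' / I) ∧ I * MT = MT ∧ F ≤ I ∧ I ≤ MT := by
  have hA0 : I' * MT ≠ 0 := EndOrder.fractionalIdeal_mul_ne_zero hI' hMT0
  obtain ⟨L₀, hL₀, hw, hIT⟩ := exists_isUnit_mul_mul_eq_of_one_mem μ hI' hA0 hMT0
    (one_mem_div_mul_div_mul_of_div_self_eq μ hTT hMT0 hI' hMS0 hIS hTS hinv)
  -- `S·I = I` for `I = L₀I′` (`S·I′ = I′`)
  have hSI : MS * (L₀ * I') = L₀ * I' := by rw [mul_left_comm, ← hIS, EndOrder.div_self_mul_self_eq hI']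
  refine ⟨L₀ * I', ⟨L₀, hL₀, rfl⟩, hw, hIT, ?_, ?_⟩
  · -- `𝔣 = 𝔣T = 𝔣(IT) = (𝔣T)I = 𝔣I ⊆ SI = I`
    calc F = F * MT := by rw [mul_comm, hTF]
      _ = F * (L₀ * I' * MT) := by rw [hIT]
      _ = MT * F * (L₀ * I') := by ring
      _ = F * (L₀ * I') := by rw [hTF]
      _ ≤ MS * (L₀ * I') := mul_le_mul' hFS le_rfl
      _ = L₀ * I' := hSI
  · rw [← hIT]
    exact EndOrder.le_mul_of_one_le (EndOrder.one_le_of_mul_self_eq hTT hMT0) _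

/-- **PROPOSITION 5.1 with «the natural choice» `𝔣 = (S:T)`** (a `T`-ideal contained in `S`, so `T ⊆ (𝔣:𝔣)` holds):
a representative `I = L₀I′ ~ I′` with `IT = T` and `(S:T) ⊆ I ⊆ T`. [cite: Marseglia2019, §5 Prop. 5.1 and the paragraph
after it («the natural choice is to take … as `𝔣`, the colon ideal `(S:T)`»), p. 10] -/
theorem exists_div_le_of_div_self_eq {I' MS TS MT : FractionalIdeal (endOrder (Algebra.leftMulMatrix μ))⁰ K}
    (hTT : MT * MT = MT) (hMT0 : MT ≠ 0) (hI' : I' ≠ 0) (hMS0 : MS ≠ 0) (hIS : I' / I' = MS)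
    (hTS : (TS : Submodule (endOrder (Algebra.leftMulMatrix μ)) K) =
      traceDual ℤ ℚ (MS : Submodule (endOrder (Algebra.leftMulMatrix μ)) K))
    (hinv : ∃ N' : FractionalIdeal (endOrder (Algebra.leftMulMatrix μ))⁰ K, TS * MT * N' = MT) :
    ∃ I : FractionalIdeal (endOrder (Algebra.leftMulMatrix μ))⁰ K,
      (∃ L₀ : FractionalIdeal (endOrder (Algebra.leftMulMatrix μ))⁰ K, IsUnit L₀ ∧ I = L₀ * I') ∧
      (1 : K) ∈ I / I' * (I' / I) ∧ I * MT = MT ∧ MS / MT ≤ I ∧ I ≤ MT :=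
  exists_le_of_div_self_eq μ hTT hMT0 hI' hMS0 hIS hTS hinv
    (EndOrder.div_le_of_one_mem hMT0 (FractionalIdeal.one_le.1 (EndOrder.one_le_of_mul_self_eq hTT hMT0)))
    (EndOrder.mul_div_eq_div_of_mul_self_eq hTT hMT0)

end CMTypeLattice

end Literature.NumberTheory.ComplexMultiplication
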